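import Mathlib

/-!
# Conjecture N (hodge-weil ladder, GAPS G51b), format (5,3): CROSS + ONE FREE ROOT — aggregate identities

Prover 2, generation 22 (note `run/shared/lean/b2b/hodge-weil/b2b-hweil-pv2-g22/CROSSPLUS1-G22.md`). Corner coordinates of generation 21's
cross lemma (`WeilClassTestFormatFiveThreeCrossLemma`): E-roots `(As + x_e + y_e, us + x_e − y_e)`, F-roots `(As − p_g − q_g, us + q_g − p_g)`,
`x, y, p, q ≥ 0`; here roots `E₂…E₅, F₁…F₃` lie ON the cross (`x·y = p·q = 0`) and `E₁ = (x₁, y₁)` is FREE. Aggregates (all sums include root 1):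
`X = Σx + Σp`, `M = Σy + Σq`, `D⁺ = Σx² − Σp²`, `D⁻ = Σy² − Σq²`, and the UNSIGNED cubic corner sums `C₃⁺ = Σx³ + Σp³`, `C₃⁻ = Σy³ + Σq³`
(the H-axis corner measure `t·μ = Σ x_e δ_{x_e} + Σ p_g δ_{−p_g}` has moments `X, D⁺, C₃⁺`). With centring `2us = M − X`, `2As = −(X+M)`:
* `S_on_cross_plus_one` : `S = D⁺ + D⁻ − (X−M)²/2 − 2x₁y₁`;
* `P4_on_cross_plus_one`, `P2_on_cross_plus_one` : the purity sums `P4 = Σεu³`, `P2 = ΣεA·u²` as polynomials in the aggregates — these two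
  determine `C₃⁺, C₃⁻` from `X, M, D±, x₁, y₁` on the pure locus;
* `K_on_cross_plus_one` : `P4 − P1` is free of the cubic sums (`P1 = ΣεA²u`), giving the relation `K = 0` of the reduced system.
All four are `linear_combination`s of the seven on-cross relations with explicit cofactors, found and verified with sympy
(`code/pv2-g22/agg/main.py`, job j127779). Pure algebra; no case of HC, no rung; no statement of Markman's papers is used. New cell result ⇒ Summits/.
-/

set_option linter.dupNamespace false
set_option maxRecDepth 16384

namespace Summit.HodgeConjecture.HodgeConjecture.WeilClassTestFormatFiveThreeCrossPlusOneAggregates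

set_option maxHeartbeats 2000000 in
/-- `S` on cross + one free E-root: `S = D⁺ + D⁻ − (X−M)²/2 − 2·x₁y₁`. -/
theorem S_on_cross_plus_one (x₁ x₂ x₃ x₄ x₅ y₁ y₂ y₃ y₄ y₅ p₁ p₂ p₃ q₁ q₂ q₃ us As : ℝ) (hus : 2 * us = (y₁ + y₂ + y₃ + y₄ + y₅ + q₁ + q₂ + q₃) - (x₁ + x₂ + x₃ + x₄ + x₅ + p₁ + p₂ + p₃)) (hAs : 2 * As = -((x₁ + x₂ + x₃ + x₄ + x₅ + p₁ + p₂ + p₃) + (y₁ + y₂ + y₃ + y₄ + y₅ + q₁ + q₂ + q₃))) (hxy₂ : x₂ * y₂ = 0) (hxy₃ : x₃ * y₃ = 0) (hxy₄ : x₄ * y₄ = 0) (hxy₅ : x₅ * y₅ = 0) (hpq₁ : p₁ * q₁ = 0) (hpq₂ : p₂ * q₂ = 0) (hpq₃ : p₃ * q₃ = 0) :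
    (((us + x₁ - y₁) ^ 2 + (us + x₂ - y₂) ^ 2 + (us + x₃ - y₃) ^ 2 + (us + x₄ - y₄) ^ 2 + (us + x₅ - y₅) ^ 2) - ((us + q₁ - p₁) ^ 2 + (us + q₂ - p₂) ^ 2 + (us + q₃ - p₃) ^ 2))
      = ((y₁ ^ 2 + y₂ ^ 2 + y₃ ^ 2 + y₄ ^ 2 + y₅ ^ 2) - (q₁ ^ 2 + q₂ ^ 2 + q₃ ^ 2)) + ((x₁ ^ 2 + x₂ ^ 2 + x₃ ^ 2 + x₄ ^ 2 + x₅ ^ 2) - (p₁ ^ 2 + p₂ ^ 2 + p₃ ^ 2)) - (y₁ + y₂ + y₃ + y₄ + y₅ + q₁ + q₂ + q₃)^2/2 + (y₁ + y₂ + y₃ + y₄ + y₅ + q₁ + q₂ + q₃)*(x₁ + x₂ + x₃ + x₄ + x₅ + p₁ + p₂ + p₃) - (x₁ + x₂ + x₃ + x₄ + x₅ + p₁ + p₂ + p₃)^2/2 - 2*x₁*y₁ := by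
  have hus' : us = ((y₁ + y₂ + y₃ + y₄ + y₅ + q₁ + q₂ + q₃) - (x₁ + x₂ + x₃ + x₄ + x₅ + p₁ + p₂ + p₃)) / 2 := by linarith
  have hAs' : As = -((x₁ + x₂ + x₃ + x₄ + x₅ + p₁ + p₂ + p₃) + (y₁ + y₂ + y₃ + y₄ + y₅ + q₁ + q₂ + q₃)) / 2 := by linarith
  subst hus' hAs'
  linear_combination (-2) * hxy₂ + (-2) * hxy₃ + (-2) * hxy₄ + (-2) * hxy₅ + (2) * hpq₁ + (2) * hpq₂ + (2) * hpq₃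

set_option maxHeartbeats 2000000 in
/-- `P4` on cross + one free E-root in the aggregates `X, M, D±, C₃±` (unsigned cubic corner sums) and `(x₁, y₁)`. -/
theorem P4_on_cross_plus_one (x₁ x₂ x₃ x₄ x₅ y₁ y₂ y₃ y₄ y₅ p₁ p₂ p₃ q₁ q₂ q₃ us As : ℝ) (hus : 2 * us = (y₁ + y₂ + y₃ + y₄ + y₅ + q₁ + q₂ + q₃) - (x₁ + x₂ + x₃ + x₄ + x₅ + p₁ + p₂ + p₃)) (hAs : 2 * As = -((x₁ + x₂ + x₃ + x₄ + x₅ + p₁ + p₂ + p₃) + (y₁ + y₂ + y₃ + y₄ + y₅ + q₁ + q₂ + q₃))) (hxy₂ : x₂ * y₂ = 0) (hxy₃ : x₃ * y₃ = 0) (hxy₄ : x₄ * y₄ = 0) (hxy₅ : x₅ * y₅ = 0) (hpq₁ : p₁ * q₁ = 0) (hpq₂ : p₂ * q₂ = 0) (hpq₃ : p₃ * q₃ = 0) :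
    (((us + x₁ - y₁) ^ 3 + (us + x₂ - y₂) ^ 3 + (us + x₃ - y₃) ^ 3 + (us + x₄ - y₄) ^ 3 + (us + x₅ - y₅) ^ 3) - ((us + q₁ - p₁) ^ 3 + (us + q₂ - p₂) ^ 3 + (us + q₃ - p₃) ^ 3))
      = -((y₁ ^ 3 + y₂ ^ 3 + y₃ ^ 3 + y₄ ^ 3 + y₅ ^ 3) + (q₁ ^ 3 + q₂ ^ 3 + q₃ ^ 3)) + ((x₁ ^ 3 + x₂ ^ 3 + x₃ ^ 3 + x₄ ^ 3 + x₅ ^ 3) + (p₁ ^ 3 + p₂ ^ 3 + p₃ ^ 3)) + 3*((y₁ ^ 2 + y₂ ^ 2 + y₃ ^ 2 + y₄ ^ 2 + y₅ ^ 2) - (q₁ ^ 2 + q₂ ^ 2 + q₃ ^ 2))*(y₁ + y₂ + y₃ + y₄ + y₅ + q₁ + q₂ + q₃)/2 - 3*((y₁ ^ 2 + y₂ ^ 2 + y₃ ^ 2 + y₄ ^ 2 + y₅ ^ 2) - (q₁ ^ 2 + q₂ ^ 2 + q₃ ^ 2))*(x₁ + x₂ + x₃ + x₄ + x₅ + p₁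 + p₂ + p₃)/2 + 3*((x₁ ^ 2 + x₂ ^ 2 + x₃ ^ 2 + x₄ ^ 2 + x₅ ^ 2) - (p₁ ^ 2 + p₂ ^ 2 + p₃ ^ 2))*(y₁ + y₂ + y₃ + y₄ + y₅ + q₁ + q₂ + q₃)/2 - 3*((x₁ ^ 2 + x₂ ^ 2 + x₃ ^ 2 + x₄ ^ 2 + x₅ ^ 2) - (p₁ ^ 2 + p₂ ^ 2 + p₃ ^ 2))*(x₁ + x₂ + x₃ + x₄ + x₅ + p₁ + p₂ + p₃)/2 - (y₁ + y₂ + y₃ + y₄ + y₅ + q₁ + q₂ + q₃)^3/2 + 3*(y₁ + y₂ + y₃ + y₄ + y₅ + q₁ + q₂ + q₃)^2*(x₁ + x₂ + x₃ + x₄ + x₅ + p₁ + p₂ + p₃)/2 - 3*(y₁ + y₂ + y₃ + y₄ + y₅ + q₁ + q₂ + q₃)*(x₁ + x₂ + x₃ + x₄ + x₅ + p₁ + p₂ + p₃)^2/2 - 3*(y₁ + y₂ + y₃ + y₄ + y₅ + q₁ + q₂ + q₃)*x₁*y₁ + (x₁ + x₂ + x₃ + x₄ + x₅ + p₁ + p₂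 + p₃)^3/2 + 3*(x₁ + x₂ + x₃ + x₄ + x₅ + p₁ + p₂ + p₃)*x₁*y₁ - 3*x₁^2*y₁ + 3*x₁*y₁^2 := by
  have hus' : us = ((y₁ + y₂ + y₃ + y₄ + y₅ + q₁ + q₂ + q₃) - (x₁ + x₂ + x₃ + x₄ + x₅ + p₁ + p₂ + p₃)) / 2 := by linarith
  have hAs' : As = -((x₁ + x₂ + x₃ + x₄ + x₅ + p₁ + p₂ + p₃) + (y₁ + y₂ + y₃ + y₄ + y₅ + q₁ + q₂ + q₃)) / 2 := by linarith
  subst hus' hAs'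
  linear_combination (3*p₁ + 3*p₂ + 3*p₃ - 3*q₁ - 3*q₂ - 3*q₃ + 3*x₁ + 3*x₃ + 3*x₄ + 3*x₅ - 3*y₁ - 3*y₃ - 3*y₄ - 3*y₅) * hxy₂ + (3*p₁ + 3*p₂ + 3*p₃ - 3*q₁ - 3*q₂ - 3*q₃ + 3*x₁ + 3*x₂ + 3*x₄ + 3*x₅ - 3*y₁ - 3*y₂ - 3*y₄ - 3*y₅) * hxy₃ + (3*p₁ + 3*p₂ + 3*p₃ - 3*q₁ - 3*q₂ - 3*q₃ + 3*x₁ + 3*x₂ + 3*x₃ + 3*x₅ - 3*y₁ - 3*y₂ - 3*y₃ - 3*y₅) * hxy₄ + (3*p₁ + 3*p₂ + 3*p₃ - 3*q₁ - 3*q₂ - 3*q₃ + 3*x₁ + 3*x₂ + 3*x₃ + 3*x₄ - 3*y₁ - 3*y₂ - 3*y₃ - 3*y₄) * hxy₅ + (-6*p₁ - 3*p₂ - 3*p₃ + 6*q₁ + 3*q₂ + 3*q₃ - 3*x₁ - 3*x₂ - 3*x₃ - 3*x₄ - 3*x₅ + 3*y₁ + 3*y₂ + 3*y₃ + 3*y₄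 + 3*y₅) * hpq₁ + (-3*p₁ - 6*p₂ - 3*p₃ + 3*q₁ + 6*q₂ + 3*q₃ - 3*x₁ - 3*x₂ - 3*x₃ - 3*x₄ - 3*x₅ + 3*y₁ + 3*y₂ + 3*y₃ + 3*y₄ + 3*y₅) * hpq₂ + (-3*p₁ - 3*p₂ - 6*p₃ + 3*q₁ + 3*q₂ + 6*q₃ - 3*x₁ - 3*x₂ - 3*x₃ - 3*x₄ - 3*x₅ + 3*y₁ + 3*y₂ + 3*y₃ + 3*y₄ + 3*y₅) * hpq₃

set_option maxHeartbeats 2000000 in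
/-- `P2` on cross + one free E-root. -/
theorem P2_on_cross_plus_one (x₁ x₂ x₃ x₄ x₅ y₁ y₂ y₃ y₄ y₅ p₁ p₂ p₃ q₁ q₂ q₃ us As : ℝ) (hus : 2 * us = (y₁ + y₂ + y₃ + y₄ + y₅ + q₁ + q₂ + q₃) - (x₁ + x₂ + x₃ + x₄ + x₅ + p₁ + p₂ + p₃)) (hAs : 2 * As = -((x₁ + x₂ + x₃ + x₄ + x₅ + p₁ + p₂ + p₃) + (y₁ + y₂ + y₃ + y₄ + y₅ + q₁ + q₂ + q₃))) (hxy₂ : x₂ * y₂ = 0) (hxy₃ : x₃ * y₃ = 0) (hxy₄ : x₄ * y₄ = 0) (hxy₅ : x₅ * y₅ = 0) (hpq₁ : p₁ * q₁ = 0) (hpq₂ : p₂ * q₂ = 0) (hpq₃ : p₃ * q₃ = 0) :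
    (((As + x₁ + y₁) * (us + x₁ - y₁) ^ 2 + (As + x₂ + y₂) * (us + x₂ - y₂) ^ 2 + (As + x₃ + y₃) * (us + x₃ - y₃) ^ 2 + (As + x₄ + y₄) * (us + x₄ - y₄) ^ 2 + (As + x₅ + y₅) * (us + x₅ - y₅) ^ 2) - ((As - p₁ - q₁) * (us + q₁ - p₁) ^ 2 + (As - p₂ - q₂) * (us + q₂ - p₂) ^ 2 + (As - p₃ - q₃) * (us + q₃ - p₃) ^ 2))
      = ((y₁ ^ 3 + y₂ ^ 3 + y₃ ^ 3 + y₄ ^ 3 + y₅ ^ 3) + (q₁ ^ 3 + q₂ ^ 3 + q₃ ^ 3)) + ((x₁ ^ 3 + x₂ ^ 3 + x₃ ^ 3 + x₄ ^ 3 + x₅ ^ 3) + (p₁ ^ 3 + p₂ ^ 3 + p₃ ^ 3)) - 3*((y₁ ^ 2 + y₂ ^ 2 + y₃ ^ 2 + y₄ ^ 2 + y₅ ^ 2) - (q₁ ^ 2 + q₂ ^ 2 + q₃ ^ 2))*(y₁ + y₂ + y₃ + y₄ + y₅ + q₁ + q₂ + q₃)/2 + ((y₁ ^ 2 + y₂ ^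 2 + y₃ ^ 2 + y₄ ^ 2 + y₅ ^ 2) - (q₁ ^ 2 + q₂ ^ 2 + q₃ ^ 2))*(x₁ + x₂ + x₃ + x₄ + x₅ + p₁ + p₂ + p₃)/2 + ((x₁ ^ 2 + x₂ ^ 2 + x₃ ^ 2 + x₄ ^ 2 + x₅ ^ 2) - (p₁ ^ 2 + p₂ ^ 2 + p₃ ^ 2))*(y₁ + y₂ + y₃ + y₄ + y₅ + q₁ + q₂ + q₃)/2 - 3*((x₁ ^ 2 + x₂ ^ 2 + x₃ ^ 2 + x₄ ^ 2 + x₅ ^ 2) - (p₁ ^ 2 + p₂ ^ 2 + p₃ ^ 2))*(x₁ + x₂ + x₃ + x₄ + x₅ + p₁ + p₂ + p₃)/2 + (y₁ + y₂ + y₃ + y₄ + y₅ + q₁ + q₂ + q₃)^3/2 - (y₁ + y₂ + y₃ + y₄ + y₅ + q₁ + q₂ + q₃)^2*(x₁ + x₂ + x₃ + x₄ + x₅ + p₁ + p₂ + p₃)/2 - (y₁ + y₂ + y₃ + y₄ + y₅ + q₁ + q₂ + q₃)*(x₁ + x₂ + x₃ + x₄ + x₅ + p₁ + p₂ + p₃)^2/2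 + (y₁ + y₂ + y₃ + y₄ + y₅ + q₁ + q₂ + q₃)*x₁*y₁ + (x₁ + x₂ + x₃ + x₄ + x₅ + p₁ + p₂ + p₃)^3/2 + (x₁ + x₂ + x₃ + x₄ + x₅ + p₁ + p₂ + p₃)*x₁*y₁ - x₁^2*y₁ - x₁*y₁^2 := by
  have hus' : us = ((y₁ + y₂ + y₃ + y₄ + y₅ + q₁ + q₂ + q₃) - (x₁ + x₂ + x₃ + x₄ + x₅ + p₁ + p₂ + p₃)) / 2 := by linarith
  have hAs' : As = -((x₁ + x₂ + x₃ + x₄ + x₅ + p₁ + p₂ + p₃) + (y₁ + y₂ + y₃ + y₄ + y₅ + q₁ + q₂ + q₃)) / 2 := by linarith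
  subst hus' hAs'
  linear_combination (p₁ + p₂ + p₃ + q₁ + q₂ + q₃ + x₁ + x₃ + x₄ + x₅ + y₁ + y₃ + y₄ + y₅) * hxy₂ + (p₁ + p₂ + p₃ + q₁ + q₂ + q₃ + x₁ + x₂ + x₄ + x₅ + y₁ + y₂ + y₄ + y₅) * hxy₃ + (p₁ + p₂ + p₃ + q₁ + q₂ + q₃ + x₁ + x₂ + x₃ + x₅ + y₁ + y₂ + y₃ + y₅) * hxy₄ + (p₁ + p₂ + p₃ + q₁ + q₂ + q₃ + x₁ + x₂ + x₃ + x₄ + y₁ + y₂ + y₃ + y₄) * hxy₅ + (-2*p₁ - p₂ - p₃ - 2*q₁ - q₂ - q₃ - x₁ - x₂ - x₃ - x₄ - x₅ - y₁ - y₂ - y₃ - y₄ - y₅) * hpq₁ + (-p₁ - 2*p₂ - p₃ - q₁ - 2*q₂ - q₃ - x₁ - x₂ - x₃ - x₄ - x₅ - y₁ - y₂ - y₃ - y₄ - y₅) * hpq₂ + (-p₁ - p₂ - 2*p₃ - q₁ - q₂ - 2*q₃ - x₁ - x₂ - x₃ - x₄ - x₅ - y₁ - y₂ - y₃ - y₄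 - y₅) * hpq₃

set_option maxHeartbeats 2000000 in
/-- `K := P4 − P1` on cross + one free E-root — free of the cubic sums. -/
theorem K_on_cross_plus_one (x₁ x₂ x₃ x₄ x₅ y₁ y₂ y₃ y₄ y₅ p₁ p₂ p₃ q₁ q₂ q₃ us As : ℝ) (hus : 2 * us = (y₁ + y₂ + y₃ + y₄ + y₅ + q₁ + q₂ + q₃) - (x₁ + x₂ + x₃ + x₄ + x₅ + p₁ + p₂ + p₃)) (hAs : 2 * As = -((x₁ + x₂ + x₃ + x₄ + x₅ + p₁ + p₂ + p₃) + (y₁ + y₂ + y₃ + y₄ + y₅ + q₁ + q₂ + q₃))) (hxy₂ : x₂ * y₂ = 0) (hxy₃ : x₃ * y₃ = 0) (hxy₄ : x₄ * y₄ = 0) (hxy₅ : x₅ * y₅ = 0) (hpq₁ : p₁ * q₁ = 0) (hpq₂ : p₂ * q₂ = 0) (hpq₃ : p₃ * q₃ = 0) :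
    (((us + x₁ - y₁) ^ 3 + (us + x₂ - y₂) ^ 3 + (us + x₃ - y₃) ^ 3 + (us + x₄ - y₄) ^ 3 + (us + x₅ - y₅) ^ 3) - ((us + q₁ - p₁) ^ 3 + (us + q₂ - p₂) ^ 3 + (us + q₃ - p₃) ^ 3)) - (((As + x₁ + y₁) ^ 2 * (us + x₁ - y₁) + (As + x₂ + y₂) ^ 2 * (us + x₂ - y₂) + (As + x₃ + y₃) ^ 2 * (us + x₃ - y₃) + (As + x₄ + y₄) ^ 2 * (us + x₄ - y₄) + (As + x₅ + y₅) ^ 2 * (us + x₅ - y₅)) - ((As - p₁ - q₁) ^ 2 * (us + q₁ - p₁) + (As - p₂ - q₂) ^ 2 * (us + q₂ - p₂) + (As - p₃ - q₃) ^ 2 * (us + q₃ - p₃)))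
      = -2*((y₁ ^ 2 + y₂ ^ 2 + y₃ ^ 2 + y₄ ^ 2 + y₅ ^ 2) - (q₁ ^ 2 + q₂ ^ 2 + q₃ ^ 2))*(x₁ + x₂ + x₃ + x₄ + x₅ + p₁ + p₂ + p₃) + 2*((x₁ ^ 2 + x₂ ^ 2 + x₃ ^ 2 + x₄ ^ 2 + x₅ ^ 2) - (p₁ ^ 2 + p₂ ^ 2 + p₃ ^ 2))*(y₁ + y₂ + y₃ + y₄ + y₅ + q₁ + q₂ + q₃) + 2*(y₁ + y₂ + y₃ + y₄ + y₅ + q₁ + q₂ + q₃)^2*(x₁ + x₂ + x₃ + x₄ + x₅ + p₁ + p₂ + p₃) - 2*(y₁ + y₂ + y₃ + y₄ + y₅ + q₁ + q₂ + q₃)*(x₁ + x₂ + x₃ + x₄ + x₅ + p₁ + p₂ + p₃)^2 - 4*(y₁ + y₂ + y₃ + y₄ + y₅ + q₁ + q₂ + q₃)*x₁*y₁ + 4*(x₁ + x₂ + x₃ + x₄ + x₅ + p₁ + p₂ + p₃)*x₁*y₁ - 4*x₁^2*y₁ + 4*x₁*y₁^2 := by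
  have hus' : us = ((y₁ + y₂ + y₃ + y₄ + y₅ + q₁ + q₂ + q₃) - (x₁ + x₂ + x₃ + x₄ + x₅ + p₁ + p₂ + p₃)) / 2 := by linarith
  have hAs' : As = -((x₁ + x₂ + x₃ + x₄ + x₅ + p₁ + p₂ + p₃) + (y₁ + y₂ + y₃ + y₄ + y₅ + q₁ + q₂ + q₃)) / 2 := by linarith
  subst hus' hAs'
  linear_combination (4*p₁ + 4*p₂ + 4*p₃ - 4*q₁ - 4*q₂ - 4*q₃ + 4*x₁ + 4*x₃ + 4*x₄ + 4*x₅ - 4*y₁ - 4*y₃ - 4*y₄ - 4*y₅) * hxy₂ + (4*p₁ + 4*p₂ + 4*p₃ - 4*q₁ - 4*q₂ - 4*q₃ + 4*x₁ + 4*x₂ + 4*x₄ + 4*x₅ - 4*y₁ - 4*y₂ - 4*y₄ - 4*y₅) * hxy₃ + (4*p₁ + 4*p₂ + 4*p₃ - 4*q₁ - 4*q₂ - 4*q₃ + 4*x₁ + 4*x₂ + 4*x₃ + 4*x₅ - 4*y₁ - 4*y₂ - 4*y₃ - 4*y₅) * hxy₄ + (4*p₁ + 4*p₂ + 4*p₃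 - 4*q₁ - 4*q₂ - 4*q₃ + 4*x₁ + 4*x₂ + 4*x₃ + 4*x₄ - 4*y₁ - 4*y₂ - 4*y₃ - 4*y₄) * hxy₅ + (-8*p₁ - 4*p₂ - 4*p₃ + 8*q₁ + 4*q₂ + 4*q₃ - 4*x₁ - 4*x₂ - 4*x₃ - 4*x₄ - 4*x₅ + 4*y₁ + 4*y₂ + 4*y₃ + 4*y₄ + 4*y₅) * hpq₁ + (-4*p₁ - 8*p₂ - 4*p₃ + 4*q₁ + 8*q₂ + 4*q₃ - 4*x₁ - 4*x₂ - 4*x₃ - 4*x₄ - 4*x₅ + 4*y₁ + 4*y₂ + 4*y₃ + 4*y₄ + 4*y₅) * hpq₂ + (-4*p₁ - 4*p₂ - 8*p₃ + 4*q₁ + 4*q₂ + 8*q₃ - 4*x₁ - 4*x₂ - 4*x₃ - 4*x₄ - 4*x₅ + 4*y₁ + 4*y₂ + 4*y₃ + 4*y₄ + 4*y₅) * hpq₃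
end Summit.HodgeConjecture.HodgeConjecture.WeilClassTestFormatFiveThreeCrossPlusOneAggregates
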